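import Mathlib
import HarnessLib
import Summits.HubbardSuperconductivity.HubbardSuperconductivity.Theorems.KLProgrammeKLRegimeEngineE4ScaleDoorFixed

/-!
# (E4)ₙ door, BIRTH-SCALE form: the first moments of the scale-`n` sectorised quartic kernel from a finite decomposition into pieces,
# each weighted AT ITS OWN SCALE

Cell gate-hubbard-kl, seat hubbard-kl-k3c3-p2 (g7); sequel of `…EngineE4ScaleDoor` (p518391) and `…EngineE4ScaleDoorFixed` (p521997), for the third
conjunct `EngineFirstMoments L M G P Q β U μ (klFlowFrameU … n) n` of stub (b) `stub_engine_step_norms` of the engine-flow child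
`KLRegimeEngineV17F2` (stmt-HubbardSuperconductivity-20437).  The fixed-label door p521997 asks, per label 4-tuple `Ω`, the weighted position sum at
LEVEL-`n` weight `klScaleWt n = 1 + Λ_n·diam` to be `≤ klE0·(cE4 + cE4′|U|)·Klam·|U|` — (mass) + Λ_n·(moment) = `O(Klam·|U|)`.  The multiscale
expansion that produces the level-`n` kernel at the flow frame `K_n` delivers it as a FINITE SUM of terms (increments born at the scales / block
boundaries `m ≤ n`, several tree terms per scale), each with Benfatto–Giuliani–Mastropietro (2.52)-type decay AT ITS OWN SCALE: a term born at `m` has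
range `Λ_m⁻¹ = 32·4^m`, so its natural bound is the weighted sum at weight `klScaleWt m`, not `klScaleWt n`.  Since `Λ_n·dist ≤ 4^{m−n}·(klScaleWt_m − 1)`
and `Σ_{m ≤ n} 4^{m−n} ≤ 4/3`, own-scale bounds with an `n`-free budget per piece still give the `n`-free (E4)ₙ allowance although the SUM of the pieces'
masses is not what bounds the cumulative kernel's mass.  This file is that bookkeeping (no analysis, no new definition):

* `dist_mul_le_four_pow_mul_wtSum_piece` — one piece: `ε_x³·Σ_x dist(x_i,x_k)·‖P(x)‖ ≤ (4^s/klE0)·(ε_x³·Σ_x klScaleWt_s(positions of (0,x))·‖P(x)‖)`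
  for ANY scale index `s` (the weight's scale, not the kernel's);
* **`firstMoment_le_of_pieces`** — a finite decomposition `W̄_Ω(0,x) = Σ_{i : ι} P_i(x)` with `ε_x³·Σ_x klScaleWt_{s_i}·‖P_i‖ ≤ B_i` gives
  `ε_x³·Σ_x dist(x_i,x_k)·‖W̄_Ω(0,x)‖ ≤ (Σ_i 4^{s_i}·B_i)/klE0`;
* **`engineFirstMoments_of_wtSum_pieces`** — THE DOOR: per `Ω` such a decomposition (pieces, scales and budgets may depend on `Ω`) with
  `Σ_i 4^{s_i}·B_i ≤ klE0·((G.cE4 + Q.cE4|U|)·P.Klam·|U|)·4ⁿ` ⇒ `EngineFirstMoments L M G P Q β U μ K n` (any frame `K`, any `n`; at `K := K_n` for (b));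
* `engineFirstMoments_of_wtSum_increments` — the one-piece-per-scale corollary: pieces `P_m`, `m ∈ range (n+1)`, weight `klScaleWt m`, UNIFORM budget
  `B ≤ ¾·klE0·((G.cE4 + Q.cE4|U|)·P.Klam·|U|)` ⇒ (E4)ₙ (`Σ_{m≤n} 4^m ≤ 4^{n+1}/3`);
(p521997 `engineFirstMoments_of_wtSum_fixed` is the one-piece case `ι = Unit`, `s = n`; not restated here.)

Consumers: the (b)-F tower instantiation (E1 lead r2d-p2, E1-TOWER-BLOCKED: BLOCKED · GRADED · BIRTH-LEVEL) if it exports the level-`n` quartic kernel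
in single-tuple currency with the birth-level weight; otherwise whoever owns the per-tuple weighted line.  Pure bookkeeping; nothing about the model
is asserted; nothing asserts superconductivity.
-/

noncomputable section

namespace Summit.HubbardSuperconductivity.HubbardSuperconductivity.Theorems.EngineV8

set_option linter.dupNamespace false -- summit = problem name (single-conjunct summit), D-0017

open Real Finset Literature.MathematicalPhysics.QuantumLattice Literature.Probability.LatticeModels
open Literature.Probability.LatticeModels.BattleFederbush
open Literature.MathematicalPhysics.QuantumLattice.GrassmannAlgebra
open Summit.HubbardSuperconductivity.HubbardSuperconductivity.Theorems.KLRegimeSplit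
open Summit.HubbardSuperconductivity.HubbardSuperconductivity.Theorems.KLProgrammeLegKernels
open Summit.HubbardSuperconductivity.HubbardSuperconductivity.Theorems.DispersionFlow

variable {L M : ℕ} [NeZero L] [NeZero M]

/-! ## §1 One piece, weighted at an arbitrary scale -/

/-- `4^s / klE0 = (Λ_s)⁻¹`: dividing by the scale is multiplying by its range. -/
theorem four_pow_div_klE0_eq_inv_klScale (s : ℕ) : (4 : ℝ) ^ s / klE0 = (klScale klE0 s)⁻¹ := by
  have h := klScale_klE0_mul_four_pow s
  have hE0 : (0 : ℝ) < klE0 := by norm_num [klE0]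
  refine eq_inv_of_mul_eq_one_left ?_
  rw [div_mul_eq_mul_div, mul_comm ((4 : ℝ) ^ s), h, div_self hE0.ne']

/-- **One piece, own scale.**  For ANY scale index `s`, any label tuple `Ω`, legs `i, k` and any function `P` of the three free positions:
`ε_x³·Σ_x dist(x_i, x_k)·‖P x‖ ≤ (4^s/klE0)·(ε_x³·Σ_x klScaleWt_s(positions of (0,x))·‖P x‖)` (`β ≥ 0`; `Λ_s·dist ≤ klScaleWt_s − 1 ≤ klScaleWt_s`). -/
theorem dist_mul_le_four_pow_mul_wtSum_piece {β : ℝ} (hβ : 0 ≤ β) (s : ℕ) {n : ℕ} (Ω : Fin 4 → SectorLeg (sectorCount n)) (i k : Fin 4)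
    (P : (Fin 3 → SpaceTimeIdx L M) → ℂ) :
    imagTimeWeight β M ^ 3 *
        ∑ x : Fin 3 → SpaceTimeIdx L M,
          KLRegimeSplit.spaceTimeDist L M β (Matrix.vecCons (0 : SpaceTimeIdx L M) x i) (Matrix.vecCons (0 : SpaceTimeIdx L M) x k) * ‖P x‖ ≤
      (4 : ℝ) ^ s / klE0 *
        (imagTimeWeight β M ^ 3 *
          ∑ x : Fin 3 → SpaceTimeIdx L M,
            klScaleWt L M β s ((univ.image (fun j : Fin 4 => (Matrix.vecCons (0 : SpaceTimeIdx L M) x j, Ω j))).image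
                (latticeLegPos (2 * (2 * M)))) * ‖P x‖) := by
  have hε : 0 ≤ imagTimeWeight β M ^ 3 := pow_nonneg (imagTimeWeight_nonneg hβ M) 3
  have hΛ := klth_klScale_pos s
  rw [four_pow_div_klE0_eq_inv_klScale, mul_left_comm]
  refine mul_le_mul_of_nonneg_left ?_ hε
  rw [mul_sum]
  refine sum_le_sum fun x _ => ?_
  rw [← mul_assoc]
  refine mul_le_mul_of_nonneg_right ?_ (norm_nonneg _)
  set X : Fin 4 → SpaceTimeIdx L M × SectorLeg (sectorCount n) := fun j => (Matrix.vecCons (0 : SpaceTimeIdx L M) x j, Ω j) with hX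
  have hd := klScale_mul_spaceTimeDist_le_klScaleWt_image_sub_one (L := L) (M := M) hβ s X i k
  have hXi : (X i).1 = Matrix.vecCons (0 : SpaceTimeIdx L M) x i := rfl
  have hXk : (X k).1 = Matrix.vecCons (0 : SpaceTimeIdx L M) x k := rfl
  rw [hXi, hXk] at hd
  have hw1 : (1 : ℝ) ≤ klScaleWt L M β s ((univ.image X).image (latticeLegPos (2 * (2 * M)))) := one_le_klScaleWt L M β s _
  rw [← div_eq_inv_mul, le_div_iff₀ hΛ, mul_comm]
  linarith

/-! ## §2 A finite decomposition into pieces -/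

/-- **First moment of a finite sum of pieces, each weighted at its own scale.**  If `W̄_Ω(0,x) = Σ_i P_i x` (finitely many pieces, scales `s_i`) and
`ε_x³·Σ_x klScaleWt_{s_i}(positions of (0,x))·‖P_i x‖ ≤ B_i`, then `ε_x³·Σ_x dist(x_i,x_k)·‖W̄_Ω(0,x)‖ ≤ (Σ_i 4^{s_i}·B_i)/klE0` (`β ≥ 0`). -/
theorem firstMoment_le_of_pieces {β : ℝ} (hβ : 0 ≤ β) {U μ : ℝ} {K : TrigPolyC4v} {n : ℕ} (Ω : Fin 4 → SectorLeg (sectorCount n)) (i k : Fin 4)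
    {ι : Type*} (T : Finset ι) (s : ι → ℕ) (P : ι → (Fin 3 → SpaceTimeIdx L M) → ℂ) (B : ι → ℝ)
    (hsum : ∀ x : Fin 3 → SpaceTimeIdx L M,
      klAnisoLegKernel L M β U μ K klE0 n 4 Ω (Matrix.vecCons (0 : SpaceTimeIdx L M) x) = ∑ a ∈ T, P a x)
    (hB : ∀ a ∈ T, imagTimeWeight β M ^ 3 *
        ∑ x : Fin 3 → SpaceTimeIdx L M,
          klScaleWt L M β (s a) ((univ.image (fun j : Fin 4 => (Matrix.vecCons (0 : SpaceTimeIdx L M) x j, Ω j))).image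
              (latticeLegPos (2 * (2 * M)))) * ‖P a x‖ ≤ B a) :
    imagTimeWeight β M ^ 3 *
        ∑ x : Fin 3 → SpaceTimeIdx L M,
          KLRegimeSplit.spaceTimeDist L M β (Matrix.vecCons (0 : SpaceTimeIdx L M) x i) (Matrix.vecCons (0 : SpaceTimeIdx L M) x k) *
            ‖klAnisoLegKernel L M β U μ K klE0 n 4 Ω (Matrix.vecCons (0 : SpaceTimeIdx L M) x)‖ ≤
      (∑ a ∈ T, (4 : ℝ) ^ (s a) * B a) / klE0 := by
  have hε : 0 ≤ imagTimeWeight β M ^ 3 := pow_nonneg (imagTimeWeight_nonneg hβ M) 3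
  set d : (Fin 3 → SpaceTimeIdx L M) → ℝ := fun x =>
    KLRegimeSplit.spaceTimeDist L M β (Matrix.vecCons (0 : SpaceTimeIdx L M) x i) (Matrix.vecCons (0 : SpaceTimeIdx L M) x k) with hd
  have hd0 : ∀ x : Fin 3 → SpaceTimeIdx L M, 0 ≤ d x := fun x => by
    rw [hd]
    unfold KLRegimeSplit.spaceTimeDist
    exact le_trans (Nat.cast_nonneg _) (le_trans (le_max_left _ _) (le_max_right _ _))
  -- step 1: the triangle inequality, piece by piece
  have h1 : imagTimeWeight β M ^ 3 * ∑ x : Fin 3 → SpaceTimeIdx L M,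
        d x * ‖klAnisoLegKernel L M β U μ K klE0 n 4 Ω (Matrix.vecCons (0 : SpaceTimeIdx L M) x)‖ ≤
      imagTimeWeight β M ^ 3 * ∑ x : Fin 3 → SpaceTimeIdx L M, ∑ a ∈ T, d x * ‖P a x‖ := by
    refine mul_le_mul_of_nonneg_left (sum_le_sum fun x _ => ?_) hε
    rw [← mul_sum]
    refine mul_le_mul_of_nonneg_left ?_ (hd0 x)
    rw [hsum x]
    exact norm_sum_le _ _
  have h1' : imagTimeWeight β M ^ 3 * ∑ x : Fin 3 → SpaceTimeIdx L M, ∑ a ∈ T, d x * ‖P a x‖ =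
      ∑ a ∈ T, imagTimeWeight β M ^ 3 * ∑ x : Fin 3 → SpaceTimeIdx L M, d x * ‖P a x‖ := by
    rw [sum_comm, mul_sum]
  -- step 2: each piece at its own scale
  have h2 : ∀ a ∈ T, imagTimeWeight β M ^ 3 * ∑ x : Fin 3 → SpaceTimeIdx L M, d x * ‖P a x‖ ≤ (4 : ℝ) ^ (s a) * B a / klE0 :=
    fun a ha => by
    refine (dist_mul_le_four_pow_mul_wtSum_piece (L := L) (M := M) hβ (s a) Ω i k (P a)).trans ?_
    rw [mul_div_right_comm]
    exact mul_le_mul_of_nonneg_left (hB a ha) (div_nonneg (pow_nonneg (by norm_num) _) (by norm_num [klE0]))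
  refine h1.trans ?_
  rw [h1', sum_div]
  exact sum_le_sum h2

/-! ## §3 The doors -/

/-- **THE (E4)ₙ DOOR, BIRTH-SCALE FORM.**  If at scale `n`, for EVERY label 4-tuple `Ω`, the sectorised quartic kernel with leg `0` at the origin is a
finite sum of pieces `P_i` with fixed-label weighted sums AT THE PIECES' OWN SCALES `ε_x³·Σ_x klScaleWt_{s_i}(positions)·‖P_i x‖ ≤ B_i` and
`Σ_i 4^{s_i}·B_i ≤ klE0·((G.cE4 + Q.cE4|U|)·P.Klam·|U|)·4ⁿ`, then `EngineFirstMoments L M G P Q β U μ K n` (`β > 0`; every frame `K`, every `n`).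
The decomposition (index set, pieces, scales, budgets) may depend on `Ω`. -/
theorem engineFirstMoments_of_wtSum_pieces {β : ℝ} (hβ : 0 < β) {U μ : ℝ} {K : TrigPolyC4v} {n : ℕ}
    {G : GeoConsts} {P : SplitConsts} {Q : EngConsts}
    (h : ∀ Ω : Fin 4 → SectorLeg (sectorCount n),
      ∃ (ι : Type) (T : Finset ι) (s : ι → ℕ) (Pc : ι → (Fin 3 → SpaceTimeIdx L M) → ℂ) (B : ι → ℝ),
        (∀ x : Fin 3 → SpaceTimeIdx L M,
            klAnisoLegKernel L M β U μ K klE0 n 4 Ω (Matrix.vecCons (0 : SpaceTimeIdx L M) x) = ∑ a ∈ T, Pc a x) ∧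
          (∀ a ∈ T, imagTimeWeight β M ^ 3 *
              ∑ x : Fin 3 → SpaceTimeIdx L M,
                klScaleWt L M β (s a) ((univ.image (fun j : Fin 4 => (Matrix.vecCons (0 : SpaceTimeIdx L M) x j, Ω j))).image
                    (latticeLegPos (2 * (2 * M)))) * ‖Pc a x‖ ≤ B a) ∧
          ∑ a ∈ T, (4 : ℝ) ^ (s a) * B a ≤ klE0 * ((G.cE4 + Q.cE4 * |U|) * P.Klam * |U|) * (4 : ℝ) ^ n) :
    EngineFirstMoments L M G P Q β U μ K n := by
  intro Ω i k
  obtain ⟨ι, T, s, Pc, B, hsum, hB, hfit⟩ := h Ω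
  have hE0 : (0 : ℝ) < klE0 := by norm_num [klE0]
  refine (firstMoment_le_of_pieces (L := L) (M := M) hβ.le Ω i k T s Pc B hsum hB).trans ?_
  rw [div_le_iff₀ hE0]
  linarith

/-- `Σ_{m ≤ n} 4^m ≤ (4/3)·4ⁿ` (real form of `Σ_{m<n+1} 4^m = (4^{n+1} − 1)/3`). -/
theorem sum_range_succ_four_pow_le (n : ℕ) : ∑ m ∈ range (n + 1), (4 : ℝ) ^ m ≤ 4 / 3 * (4 : ℝ) ^ n := by
  have h : (∑ m ∈ range (n + 1), (4 : ℝ) ^ m) * 3 ≤ 4 * (4 : ℝ) ^ n := by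
    have e : (∑ m ∈ range (n + 1), (4 : ℝ) ^ m) * (4 - 1) = (4 : ℝ) ^ (n + 1) - 1 := geom_sum_mul _ _
    have h4 : (0 : ℝ) ≤ 1 := zero_le_one
    nlinarith [e, pow_succ (4 : ℝ) n]
  linarith

/-- **(E4)ₙ from one piece per scale with a UNIFORM own-scale budget.**  If for every `Ω` the level-`n` sectorised quartic kernel with leg `0` at the
origin is `Σ_{m ∈ range (n+1)} P_m x` with `ε_x³·Σ_x klScaleWt_m(positions)·‖P_m x‖ ≤ B` for every `m ≤ n`, and
`B ≤ ¾·klE0·((G.cE4 + Q.cE4|U|)·P.Klam·|U|)`, then `EngineFirstMoments L M G P Q β U μ K n` (`β > 0`). -/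
theorem engineFirstMoments_of_wtSum_increments {β : ℝ} (hβ : 0 < β) {U μ : ℝ} {K : TrigPolyC4v} {n : ℕ}
    {G : GeoConsts} {P : SplitConsts} {Q : EngConsts} {B : ℝ}
    (hBfit : B ≤ 3 / 4 * (klE0 * ((G.cE4 + Q.cE4 * |U|) * P.Klam * |U|)))
    (h : ∀ Ω : Fin 4 → SectorLeg (sectorCount n), ∃ Pc : ℕ → (Fin 3 → SpaceTimeIdx L M) → ℂ,
        (∀ x : Fin 3 → SpaceTimeIdx L M,
            klAnisoLegKernel L M β U μ K klE0 n 4 Ω (Matrix.vecCons (0 : SpaceTimeIdx L M) x) = ∑ m ∈ range (n + 1), Pc m x) ∧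
          ∀ m ∈ range (n + 1), imagTimeWeight β M ^ 3 *
              ∑ x : Fin 3 → SpaceTimeIdx L M,
                klScaleWt L M β m ((univ.image (fun j : Fin 4 => (Matrix.vecCons (0 : SpaceTimeIdx L M) x j, Ω j))).image
                    (latticeLegPos (2 * (2 * M)))) * ‖Pc m x‖ ≤ B) :
    EngineFirstMoments L M G P Q β U μ K n := by
  refine engineFirstMoments_of_wtSum_pieces (L := L) (M := M) hβ fun Ω => ?_
  obtain ⟨Pc, hsum, hB⟩ := h Ω
  refine ⟨ℕ, range (n + 1), id, Pc, fun _ => B, hsum, fun m hm => hB m hm, ?_⟩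
  have hB0 : 0 ≤ B := by
    obtain ⟨-, hB'⟩ := h Ω
    have h0 := hB 0 (by simp)
    refine le_trans (mul_nonneg (pow_nonneg (imagTimeWeight_nonneg hβ.le M) 3) (sum_nonneg fun x _ => ?_)) h0
    exact mul_nonneg (zero_le_one.trans (one_le_klScaleWt L M β 0 _)) (norm_nonneg _)
  calc ∑ a ∈ range (n + 1), (4 : ℝ) ^ (id a) * B = (∑ m ∈ range (n + 1), (4 : ℝ) ^ m) * B := by rw [sum_mul]; rfl
    _ ≤ 4 / 3 * (4 : ℝ) ^ n * B := mul_le_mul_of_nonneg_right (sum_range_succ_four_pow_le n) hB0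
    _ ≤ 4 / 3 * (4 : ℝ) ^ n * (3 / 4 * (klE0 * ((G.cE4 + Q.cE4 * |U|) * P.Klam * |U|))) :=
        mul_le_mul_of_nonneg_left hBfit (by positivity)
    _ = klE0 * ((G.cE4 + Q.cE4 * |U|) * P.Klam * |U|) * (4 : ℝ) ^ n := by ring

end Summit.HubbardSuperconductivity.HubbardSuperconductivity.Theorems.EngineV8

end
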